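/-
Copyright (c) 2026 the pub-hodgecm-mathlib formalisation cell (harness21).  Prover seat hodgecm-mathlib-K2E1-p08 (g5), Track B ∕ K2-LIT, h413 =
`stmt-HodgeConjecture-24833`, campaign «EIS-RANK-ONE», [D5] census finding (LETTERS): the hypothesis pair `IsOpen U ∧ U ≤ K_U` of the `N = 2` R6d₂ editions A∕B is empty.
-/
import Summits.HodgeConjecture.HodgeConjecture.Theorems.K2E1BorelEisensteinGodementU   -- ★ p857410: `borelHeight_mul_of_adelicVal_mem` (`H(y k) = H(y)` on `K_U`)
import Summits.HodgeConjecture.HodgeConjecture.Theorems.K2E1HeightFunctionU3         -- ★ p857223: `borelHeight_one`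
import Literature.NumberTheory.Automorphic.UnitaryGroupTorusRayTwo                    -- ★ `exists_torusRay_two` (the continuous diagonal ray, `H(ρ(s) t) = e^{[E:ℚ]s} H(t)`)
import HarnessLib

/-!
# K2·E1 — `K2E1MaximalCompactNoOpenSubgroupU2`: `K_U = K_∞·GL₂(𝒪̂_E) ∩ U(J₂)(𝔸_F)` CONTAINS NO OPEN SUBGROUP OF `U(J₂)(𝔸_F)` —
# the hypothesis pair `(hUo : IsOpen U) (hUK : U ≤ K_U)` of the `N = 2` R6d₂ editions A∕B is unsatisfiable (letters finding of the [D5] census)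

Track B ∕ K2-LIT, crux h413 = `stmt-HodgeConjecture-24833`, route of record `HCCMUnconditional`; cell `hodgecm-mathlib`, squad K2, ENGINE E1, campaign EIS-RANK-ONE, [D5] census
(dealer K2E1-plan (g3) 06:06:06Z).  Prover seat `hodgecm-mathlib-K2E1-p08` (g5).  THEOREMS ONLY (no `def`, no `instance`, no notation, no named-fact hypothesis, no `sorry`); lane
`--kind proof --supports stmt-HodgeConjecture-24833 --as helper` (count-neutral, closes no socket).

THE POINT.  ★ `K2E1EisensteinMinusConstantTermBoundedCMTwo.exists_bound_sub_borelConstantTerm_cm_two` (edition A) and ★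
`K2E1EisensteinMinusConstantTermBoundedArchCMTwo.…_of_archSmooth` (edition B) quantify over a subgroup `U ≤ G(𝔸) = U(J₂)(𝔸_F)` with BOTH `hUo : IsOpen (U : Set G(𝔸))` and
`hUK : U ≤ K_U` (`K_U = (standardMaximalCompactGL 2 E).comap adelicVal`).  No such `U` exists: an open subgroup is clopen (Mathlib `Subgroup.isClosed_of_isOpen`), so it contains
the connected set `ρ(ℝ)` through `1` traced by the continuous diagonal ray `ρ` of ★ `exists_torusRay_two`; but the Borel height is right-`K_U`-invariant (★
`borelHeight_mul_of_adelicVal_mem`) while `H(ρ(1)) = e^{[E:ℚ]}·H(1) ≠ H(1)`.  Hence those theorems hold vacuously as typed; the repair (the consumer's call) is to ask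
right-invariance of `φ` under an open `U` WITHOUT `U ≤ K_U` (the tube lemma only needs openness) and take the `K_U`-invariance of `H` from ★ directly.
* `not_isOpen_of_le_comap_standardMaximalCompactGL_two` — for `c² = 1` and every subgroup `U ≤ K_U`: `¬ IsOpen U`.
* `isEmpty_subtype_isOpen_and_le_two` — packaged: no `U` satisfies both.
[Borel1963, §5 (the maximal compact subgroup is not open: `G_∞` is a non-compact connected Lie group); Rogawski1990, §2.2.]

HONEST LABEL: HC_CM is proved only modulo the 7 printed citations (2 remaining named inputs: hLiu418 = `stmt-HodgeConjecture-24832`, h413 = `stmt-HodgeConjecture-24833`) until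
rung 0 closes; count-neutral helper (a letters finding), closes no socket, refutes no socket.

## References
* [Borel1963] A. Borel, *Some finiteness properties of adele groups over number fields*, Publ. Math. IHÉS 16 (1963), §5.
* [Rogawski1990] J. D. Rogawski, *Automorphic Representations of Unitary Groups in Three Variables*, Ann. of Math. Stud. 123 (1990), §2.2 (p. 13).
-/

set_option autoImplicit false
-- the mandated namespace repeats the single-problem summit's segment (`HodgeConjecture.HodgeConjecture`)
set_option linter.dupNamespace false

noncomputable section

open Set Topology NumberField IsDedekindDomain
open scoped NNReal
open Literature.NumberTheory.Automorphic Literature.NumberTheory.Automorphic.UnitaryGroup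
open Summit.HodgeConjecture.HodgeConjecture.Cruxes.H413.K2E1BorelEisensteinGodementU (borelHeight_mul_of_adelicVal_mem)
open Summit.HodgeConjecture.HodgeConjecture.Cruxes.H413.K2E1HeightFunctionU3 (borelHeight_one)

namespace Summit.HodgeConjecture.HodgeConjecture.Cruxes.H413.K2E1MaximalCompactNoOpenSubgroupU2

variable {F E : Type} [Field F] [NumberField F] [Field E] [NumberField E] [Algebra F E] {c : E ≃ₐ[F] E}

/-- **`K_U` CONTAINS NO OPEN SUBGROUP OF `U(J₂)(𝔸_F)`** (`c² = 1`): if `U ≤ K_U = comap adelicVal (K_∞·GL₂(𝒪̂_E))` then `U` is not open in `G(𝔸)`.  An open subgroup is clopen, so it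
contains the connected image of the diagonal ray `ρ : ℝ → T(𝔸_F)` (★ `exists_torusRay_two`, `ρ(0) = 1`); then `ρ(1) ∈ K_U` and `H(ρ(1)) = H(1)` (★ `borelHeight_mul_of_adelicVal_mem`),
contradicting the height law `H(ρ(1)) = e^{[E:ℚ]}·H(1)`. [cite: Borel1963, §5] [cite: Rogawski1990, §2.2 (p. 13)] -/
theorem not_isOpen_of_le_comap_standardMaximalCompactGL_two (hc : c * c = 1) {U : Subgroup (quasiSplit F E c 2).Adelic}
    (hUK : U ≤ ((standardMaximalCompactGL 2 E).comap (adelicVal F E c 2 ((StdForm.antidiagonal 2).over E)) : Subgroup (quasiSplit F E c 2).Adelic)) :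
    ¬ IsOpen (U : Set (quasiSplit F E c 2).Adelic) := by
  intro hUo
  obtain ⟨ρ, hρc, hρadd, -, hH⟩ := exists_torusRay_two (F := F) (E := E) (c := c) hc
  -- the ray as a continuous path in `G(𝔸)` through `1`
  set γ : ℝ → (quasiSplit F E c 2).Adelic := fun s => (((ρ s : torusInBorel F E c 2) : borelAdelic F E c 2) : (quasiSplit F E c 2).Adelic) with hγ
  have hγc : Continuous γ := continuous_subtype_val.comp (continuous_subtype_val.comp hρc)
  have hρ0 : ρ 0 = 1 := by
    have h := hρadd 0 0
    rw [add_zero] at h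
    have h' : ρ 0 * ρ 0 = ρ 0 * 1 := by rw [mul_one]; exact h.symm
    exact mul_left_cancel h'
  have hγ0 : γ 0 = 1 := by simp only [hγ, hρ0]; rfl
  -- an open subgroup is clopen and contains the connected range of `γ`
  have hclopen : IsClopen (U : Set (quasiSplit F E c 2).Adelic) := ⟨Subgroup.isClosed_of_isOpen U hUo, hUo⟩
  have hsub : Set.range γ ⊆ (U : Set (quasiSplit F E c 2).Adelic) :=
    (isPreconnected_range hγc).subset_isClopen hclopen ⟨1, ⟨0, hγ0⟩, U.one_mem⟩
  -- `ρ(1) ∈ K_U`: `H(ρ(1)) = H(1 · ρ(1)) = H(1)`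
  have hmem := hUK (hsub ⟨1, rfl⟩)
  have hH1 : borelHeight (γ 1) = borelHeight (1 : (quasiSplit F E c 2).Adelic) := by
    have h := borelHeight_mul_of_adelicVal_mem (Subgroup.mem_comap.1 hmem) (1 : (quasiSplit F E c 2).Adelic)
    rwa [one_mul] at h
  -- the height law along the ray: `H(ρ(1)) = e^{[E:ℚ]} · H(1)`
  have hH2 := hH 1 1
  rw [mul_one] at hH2
  change (borelHeight (γ 1) : ℝ) = _ at hH2
  rw [hH1, borelHeight_one, OneMemClass.coe_one, OneMemClass.coe_one, borelHeight_one, NNReal.coe_one, mul_one, mul_one] at hH2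
  have hn : (0 : ℝ) < Module.finrank ℚ E := by exact_mod_cast Module.finrank_pos
  have : Real.exp (Module.finrank ℚ E : ℝ) = 1 := hH2.symm
  rw [Real.exp_eq_one_iff] at this
  exact hn.ne' this

/-- **PACKAGED**: no subgroup of `U(J₂)(𝔸_F)` is both open and contained in `K_U` — the hypothesis pair `(hUo, hUK)` of the `N = 2` R6d₂ editions A∕B is empty. [cite: Borel1963, §5] -/
theorem not_exists_isOpen_and_le_two (hc : c * c = 1) :
    ¬ ∃ U : Subgroup (quasiSplit F E c 2).Adelic, IsOpen (U : Set (quasiSplit F E c 2).Adelic) ∧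
      U ≤ ((standardMaximalCompactGL 2 E).comap (adelicVal F E c 2 ((StdForm.antidiagonal 2).over E)) : Subgroup (quasiSplit F E c 2).Adelic) := by
  rintro ⟨U, hUo, hUK⟩
  exact not_isOpen_of_le_comap_standardMaximalCompactGL_two hc hUK hUo

end Summit.HodgeConjecture.HodgeConjecture.Cruxes.H413.K2E1MaximalCompactNoOpenSubgroupU2

end
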